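import Summits.CriticalPhenomena.PercolationContinuityZ3.Theorems.PercNearOneGluingNoHeavyLowerTailSunflowerLocalAssignment
import HarnessLib
import HarnessLib.Audit

/-!
# `NoHeavyLowerTail` (crux stmt-CriticalPhenomena-4575), abstract sunflower cubic: ★ FROM THE ν/μ-SPAN INEQUALITY — the slack of the cubes
# is bounded below by the spans of their CANONICAL kernel vectors, with no rainbow vector involved

Support file (seat `prim-l12-p2` gen 24; `--supports stmt-CriticalPhenomena-4575`).  No `sorry`, no new definitions.
Memo: run/shared/lean/prim/prim-l12/prim-l12-p2/FINDING-g24-LOCAL-ASSIGNMENT.md (§6).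

For a bottom block `L` the `(1|4)`-kernel vectors `ν_P` (`P ∈ P14(Lᶜ)`: `lab P = 1`, `lab (Lᶜ∖P) = 4`; `ν_P(σ) = #{R ∈ A : P ⊆ R ⊆ σ.1}`) and for a
kernel block `K` the `(3|0)`-kernel vectors `μ_Q` (`Q ∈ P30(Kᶜ)`; `μ_Q(σ) = #{R' ∈ B : (σ.1∪σ.2)ᶜ ⊆ R' ⊆ Q}`) lie in the kernel of the spectator rows
of their cube (`nu_mem_ker`, `mu_mem_ker`, gen 18), hence
* `Sunflower.finrank_span_le_cubeSlack` — for ANY family of vectors on the supplies of a block that is orthogonal to the block's spectator rows,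
  `dim span ≤ cubeSlack` (rank–nullity in the cube; generalises `card_le_cubeSlack_of_blockIndependent`);
* `Sunflower.nu_orth_block`, `Sunflower.mu_orth_block` — the block forms of the kernel lemmas;
* **`Sunflower.ZH_nonneg_of_nuMuSpan`** — ★ for every sunflower satisfying the ν/μ-SPAN INEQUALITY
      `#rainbows ≤ Σ_{lab L = 0} dim span{ν_P : P ∈ P14(Lᶜ)} + Σ_{lab K = 4} dim span{μ_Q : Q ∈ P30(Kᶜ)}`      (NSI).
NSI is implied by every statement of the GF(2) programme (RKI ⟹ MP ⟹ LMP ⟹ DIST ⟹ NSI ⟹ ★: the rainbow spans are sub-spans of these), and it is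
the first sufficient condition in which the rainbows enter only through their NUMBER: with `#rainbows = Σ_P #CR₂₃(Pᶜ)` and
`Σ_L #P14(Lᶜ) = Σ_P #AB(Pᶜ)` (`P` over petal-1 sets with kernel complement) it reads
      `Σ_{L∈B} e(Lᶜ) + Σ_{K∈A} e*(Kᶜ) ≤ Σ_P (#AB(Pᶜ) − #CR₂₃(Pᶜ)) + Σ_Q #AB(Qᶜ)`,
`e(W)` = number of independent relations among the `ν_P` of `W` (the even families of gen 23 §4), `e*` dually.  CENSUS (gen 24, `code/nuspan.c`;
kit job j147891 for n = 5 exhaustive): 0 violations on n ≤ 4 exhaustive (780; 288 tight), 3·10⁴ random/hard sunflowers on 5–8 points (tight in ≈ 35 %),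
6 766 compositions (879 tight), the doubled star (tight).  The typed conjecture is filed in `…SunflowerNuSpanInequality` (companion).
-/

namespace Summit.CriticalPhenomena.PercolationContinuityZ3.Theorems.SunflowerPartition

open Finset

variable {α : Type*} [Fintype α] [DecidableEq α]

namespace Sunflower

variable (F : Sunflower α)

/-- **KERNEL DIMENSION BOUND OF A BLOCK** (this work).  Let `lab S ∈ {0,4}` and let `v` be ANY family of vectors on the supplies with spectator
block `S` that is orthogonal to the spectator rows of the cube `Sᶜ`.  Then `dim span v ≤ cubeSlack Sᶜ` (the nullity of the block is
`#AB(Sᶜ) − #CR(Sᶜ)`: `specRows_indep`, `card_sup_fiber`, `card_dem_spec_fiber`). [this work] -/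
theorem finrank_span_le_cubeSlack (S : Finset α) (hS : F.lab S = 4 ∨ F.lab S = 0) {ι : Type*}
    (v : ι → ↥(F.sup.filter (fun σ => σ.2 = S)) → ZMod 2)
    (horth : ∀ i, ∀ d ∈ (F.dem.filter (fun d => ¬ F.IsRainbow d)).filter (fun d => d.1 = S),
      (∑ σ : ↥(F.sup.filter (fun σ => σ.2 = S)), F.specRow d σ.1 * v i σ) = 0) :
    (Module.finrank (ZMod 2) (Submodule.span (ZMod 2) (Set.range v)) : ℤ) ≤ F.cubeSlack Sᶜ := by
  classical
  let Rm : Matrix ↥((F.dem.filter (fun d => ¬ F.IsRainbow d)).filter (fun d => d.1 = S)) ↥(F.sup.filter (fun σ => σ.2 = S)) (ZMod 2) :=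
    Matrix.of fun d σ => F.specRow d.1 σ.1
  -- (1) the rows of `Rm` are independent
  have hinj : Function.Injective (Matrix.mulVecLin Rm.transpose) := by
    rw [← LinearMap.ker_eq_bot, LinearMap.ker_eq_bot']
    intro g hg
    let c : Finset α × Finset α → ZMod 2 := fun d =>
      if hd : d ∈ (F.dem.filter (fun d => ¬ F.IsRainbow d)).filter (fun d => d.1 = S) then g ⟨d, hd⟩ else 0
    have hc : ∀ σ ∈ F.sup, (∑ d ∈ F.dem.filter (fun d => ¬ F.IsRainbow d), c d * F.specRow d σ) = 0 := by
      intro σ hσ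
      have hsplit : (∑ d ∈ F.dem.filter (fun d => ¬ F.IsRainbow d), c d * F.specRow d σ)
          = ∑ d ∈ (F.dem.filter (fun d => ¬ F.IsRainbow d)).filter (fun d => d.1 = S), c d * F.specRow d σ := by
        symm
        refine Finset.sum_subset (Finset.filter_subset _ _) fun d _ hdn => ?_
        simp only [c, dif_neg hdn, zero_mul]
      rw [hsplit]
      by_cases hσV : σ ∈ F.sup.filter (fun σ => σ.2 = S)
      · have h0 : (Rm.transpose.mulVec g) ⟨σ, hσV⟩ = 0 :=
          congrFun (show Rm.transpose.mulVec g = 0 from (Matrix.mulVecLin_apply Rm.transpose g).symm.trans hg) ⟨σ, hσV⟩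
        simp only [Matrix.mulVec, dotProduct, Matrix.transpose_apply, Rm, Matrix.of_apply] at h0
        rw [← Finset.sum_coe_sort ((F.dem.filter (fun d => ¬ F.IsRainbow d)).filter (fun d => d.1 = S))]
        refine Eq.trans (sum_congr rfl fun x _ => ?_) h0
        simp only [c, dif_pos x.2]
        ring
      · refine sum_eq_zero fun d hd => ?_
        have hdv : d.1 = S := (mem_filter.1 hd).2
        have hne : σ.2 ≠ d.1 := fun h => hσV (mem_filter.2 ⟨hσ, by rw [h, hdv]⟩)
        unfold specRow
        rw [if_neg hne, mul_zero]
    have hz := F.specRows_indep c hc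
    funext x
    have := hz x.1 (mem_filter.1 x.2).1
    simp only [c, dif_pos x.2] at this
    rw [this, Pi.zero_apply]
  -- (2) rank of the row map
  have hrank : Module.finrank (ZMod 2) (LinearMap.range (Matrix.mulVecLin Rm))
      = Fintype.card ↥((F.dem.filter (fun d => ¬ F.IsRainbow d)).filter (fun d => d.1 = S)) := by
    have h1 : Rm.rank = Rm.transpose.rank := (Matrix.rank_transpose Rm).symm
    unfold Matrix.rank at h1
    rw [h1, LinearMap.finrank_range_of_inj hinj, Module.finrank_fintype_fun_eq_card]
  -- (3) the family lies in the kernel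
  have hker : Submodule.span (ZMod 2) (Set.range v) ≤ LinearMap.ker (Matrix.mulVecLin Rm) := by
    rw [Submodule.span_le]
    rintro w ⟨i, rfl⟩
    rw [SetLike.mem_coe, LinearMap.mem_ker, Matrix.mulVecLin_apply]
    funext d
    simp only [Matrix.mulVec, dotProduct, Rm, Matrix.of_apply, Pi.zero_apply]
    exact horth i d.1 d.2
  -- (4) count dimensions
  have hrn := LinearMap.finrank_range_add_finrank_ker (Matrix.mulVecLin Rm)
  rw [Module.finrank_fintype_fun_eq_card, hrank] at hrn
  have hle := Submodule.finrank_mono hker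
  have hcards : Fintype.card ↥((F.dem.filter (fun d => ¬ F.IsRainbow d)).filter (fun d => d.1 = S))
      + Module.finrank (ZMod 2) (Submodule.span (ZMod 2) (Set.range v)) ≤ Fintype.card ↥(F.sup.filter (fun σ => σ.2 = S)) := by omega
  rw [Fintype.card_coe, Fintype.card_coe] at hcards
  rw [F.card_dem_spec_fiber S, if_pos hS, F.card_sup_fiber S, if_pos hS] at hcards
  unfold cubeSlack
  have : ((F.crCard Sᶜ + Module.finrank (ZMod 2) (Submodule.span (ZMod 2) (Set.range v)) : ℕ) : ℤ) ≤ ((F.abCard Sᶜ : ℕ) : ℤ) := by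
    exact_mod_cast hcards
  push_cast at this
  linarith

/-- **The `(1|4)`-kernel vector `ν_P` of a bottom cube is orthogonal to its spectator rows** (block form of `nu_mem_ker`): for a non-rainbow
demand `d` with bottom spectator `d.1` and `P ⊆ d.1ᶜ` with `lab P = 1`, `lab (d.1ᶜ ∖ P) = 4`. [this work] -/
theorem nu_orth_block {d : Finset α × Finset α} (hd : d ∈ F.dem.filter (fun d => ¬ F.IsRainbow d)) (hL0 : F.lab d.1 = 0)
    {P : Finset α} (hP : P ⊆ d.1ᶜ) (hP1 : F.lab P = 1) (hcP : F.lab (d.1ᶜ \ P) = 4) :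
    (∑ σ : ↥(F.sup.filter (fun σ => σ.2 = d.1)), F.specRow d σ.1 *
        (∑ R ∈ (d.1ᶜ).powerset, (if F.lab R = 4 ∧ P ⊆ R ∧ R ⊆ σ.1.1 then (1 : ZMod 2) else 0))) = 0 := by
  obtain ⟨hdd, hnr⟩ := mem_filter.1 hd
  obtain ⟨hdisj, -, hX0, hX4, hY0, hY4, hlt⟩ := F.dem_spec_facts hdd hnr
  have hXd : d.1ᶜ \ (d.1 ∪ d.2)ᶜ = d.2 := compl_sdiff_third hdisj
  have hYW : (d.1 ∪ d.2)ᶜ ⊆ d.1ᶜ := third_subset_compl d.1 d.2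
  have hY1 : F.lab (d.1 ∪ d.2)ᶜ ≠ 1 := by
    rcases petal_lt_cases _ _ hX0 hX4 hY0 hY4 hlt with ⟨-, h | h⟩ | ⟨-, h⟩ <;> rw [h] <;> decide
  rw [Finset.sum_coe_sort (F.sup.filter (fun σ => σ.2 = d.1))
    (fun σ => F.specRow d σ * (∑ R ∈ (d.1ᶜ).powerset, (if F.lab R = 4 ∧ P ⊆ R ∧ R ⊆ σ.1 then (1 : ZMod 2) else 0))),
    Finset.sum_filter, F.sum_sup_spectator d.1 (Or.inr hL0)]
  have key := F.nu_mem_ker d.1ᶜ hYW hP hY4 (by rw [hXd]; exact hX4) hY1 hP1 hcP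
  rw [← Finset.sum_filter_add_sum_filter_not (d.1ᶜ).powerset (fun O => F.lab O = 0 ∧ F.lab (d.1ᶜ \ O) = 4)] at key
  rw [show (∑ O ∈ (d.1ᶜ).powerset.filter (fun O => ¬ (F.lab O = 0 ∧ F.lab (d.1ᶜ \ O) = 4)),
        (∑ R' ∈ (d.1ᶜ).powerset, (if F.lab R' = 0 ∧ O ⊆ R' ∧ R' ⊆ (d.1 ∪ d.2)ᶜ then (1 : ZMod 2) else 0)) *
        (∑ R ∈ (d.1ᶜ).powerset, (if F.lab R = 4 ∧ P ⊆ R ∧ R ⊆ d.1ᶜ \ O then (1 : ZMod 2) else 0))) = 0 from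
      sum_eq_zero fun O hO => by
        have hO' := (mem_filter.1 hO).2
        by_cases h0 : F.lab O = 0
        · have h4 : F.lab (d.1ᶜ \ O) ≠ 4 := fun h => hO' ⟨h0, h⟩
          rw [show (∑ R ∈ (d.1ᶜ).powerset, (if F.lab R = 4 ∧ P ⊆ R ∧ R ⊆ d.1ᶜ \ O then (1 : ZMod 2) else 0)) = 0 from
            sum_eq_zero fun R _ => if_neg fun h' => h4 (F.lab_eq_four_of_subset h'.2.2 h'.1), mul_zero]
        · rw [F.crossM_eq_zero_of_lab_ne d.1ᶜ h0, zero_mul], add_zero] at key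
  refine Eq.trans (sum_congr rfl fun O hO => ?_) key
  have hOW : O ⊆ d.1ᶜ := mem_powerset.1 (mem_filter.1 hO).1
  have h3 : ((d.1ᶜ \ O) ∪ d.1)ᶜ = O := third_of_mk hOW
  unfold specRow
  simp only
  rw [if_true, if_pos hL0, h3]

/-- **The `(3|0)`-kernel vector `μ_Q` of a kernel cube is orthogonal to its spectator rows** (block form of `mu_mem_ker`): for a non-rainbow
demand `d` with kernel spectator `d.1` and `Q ⊆ d.1ᶜ` with `lab Q = 3`, `lab (d.1ᶜ ∖ Q) = 0`. [this work] -/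
theorem mu_orth_block {d : Finset α × Finset α} (hd : d ∈ F.dem.filter (fun d => ¬ F.IsRainbow d)) (hK4 : F.lab d.1 = 4)
    {Q : Finset α} (hQ : Q ⊆ d.1ᶜ) (hQ3 : F.lab Q = 3) (hcQ : F.lab (d.1ᶜ \ Q) = 0) :
    (∑ σ : ↥(F.sup.filter (fun σ => σ.2 = d.1)), F.specRow d σ.1 *
        (∑ R' ∈ (d.1ᶜ).powerset, (if F.lab R' = 0 ∧ (σ.1.1 ∪ σ.1.2)ᶜ ⊆ R' ∧ R' ⊆ Q then (1 : ZMod 2) else 0))) = 0 := by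
  obtain ⟨hdd, hnr⟩ := mem_filter.1 hd
  obtain ⟨hdisj, -, hX0, hX4, hY0, hY4, hlt⟩ := F.dem_spec_facts hdd hnr
  have hXd : d.1ᶜ \ (d.1 ∪ d.2)ᶜ = d.2 := compl_sdiff_third hdisj
  have hYW : (d.1 ∪ d.2)ᶜ ⊆ d.1ᶜ := third_subset_compl d.1 d.2
  have hX3 : F.lab d.2 ≠ 3 := by
    rcases petal_lt_cases _ _ hX0 hX4 hY0 hY4 hlt with ⟨h, -⟩ | ⟨h, -⟩ <;> rw [h] <;> decide
  have hS0 : F.lab d.1 ≠ 0 := by rw [hK4]; decide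
  rw [Finset.sum_coe_sort (F.sup.filter (fun σ => σ.2 = d.1))
    (fun σ => F.specRow d σ * (∑ R' ∈ (d.1ᶜ).powerset, (if F.lab R' = 0 ∧ (σ.1 ∪ σ.2)ᶜ ⊆ R' ∧ R' ⊆ Q then (1 : ZMod 2) else 0))),
    Finset.sum_filter, F.sum_sup_spectator d.1 (Or.inl hK4)]
  have key := F.mu_mem_ker d.1ᶜ hYW hQ hY0 (by rw [hXd]; exact hX0) (by rw [hXd]; exact hX4) (by rw [hXd]; exact hX3) hQ3 hcQ
  rw [← Finset.sum_filter_add_sum_filter_not (d.1ᶜ).powerset (fun O => F.lab O = 0 ∧ F.lab (d.1ᶜ \ O) = 4)] at key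
  rw [show (∑ O ∈ (d.1ᶜ).powerset.filter (fun O => ¬ (F.lab O = 0 ∧ F.lab (d.1ᶜ \ O) = 4)),
        (∑ R' ∈ (d.1ᶜ).powerset, (if F.lab R' = 0 ∧ O ⊆ R' ∧ R' ⊆ Q then (1 : ZMod 2) else 0)) *
        (∑ R ∈ (d.1ᶜ).powerset, (if F.lab R = 4 ∧ d.1ᶜ \ (d.1 ∪ d.2)ᶜ ⊆ R ∧ R ⊆ d.1ᶜ \ O then (1 : ZMod 2) else 0))) = 0 from
      sum_eq_zero fun O hO => by
        have hO' := (mem_filter.1 hO).2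
        by_cases h0 : F.lab O = 0
        · have h4 : F.lab (d.1ᶜ \ O) ≠ 4 := fun h => hO' ⟨h0, h⟩
          rw [F.crossN_eq_zero_of_lab_ne d.1ᶜ h4, mul_zero]
        · rw [F.crossM_eq_zero_of_lab_ne d.1ᶜ h0, zero_mul], add_zero] at key
  refine Eq.trans (sum_congr rfl fun O hO => ?_) key
  have hOW : O ⊆ d.1ᶜ := mem_powerset.1 (mem_filter.1 hO).1
  have h3 : ((d.1ᶜ \ O) ∪ d.1)ᶜ = O := third_of_mk hOW
  unfold specRow
  simp only
  rw [if_true, if_neg hS0, h3, mul_comm]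

/-- **★ FROM THE ν/μ-SPAN INEQUALITY** (this work).  If the number of rainbows is at most the total dimension of the spans of the
`(1|4)`-kernel vectors `ν_P` (`P ∈ P14(Lᶜ)`) of the bottom cubes plus that of the `(3|0)`-kernel vectors `μ_Q` (`Q ∈ P30(Kᶜ)`) of the kernel
cubes, then `0 ≤ ZH`: each span sits in the kernel of its cube's spectator rows (`nu_orth_block`, `mu_orth_block`), so its dimension is at most
`cubeSlack` (`finrank_span_le_cubeSlack`), and `ZH = 6·(Σ cubeSlack − #rainbows)` (`ZH_eq_six_slack`).  No rainbow vector is involved. [this work] -/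
theorem ZH_nonneg_of_nuMuSpan
    (h : (F.rainbowCard : ℤ) ≤
      (∑ L ∈ (Finset.univ : Finset (Finset α)).filter (fun L => F.lab L = 0),
        (Module.finrank (ZMod 2) (Submodule.span (ZMod 2) (Set.range
          (fun P : ↥((Lᶜ).powerset.filter (fun P => F.lab P = 1 ∧ F.lab (Lᶜ \ P) = 4)) =>
            fun σ : ↥(F.sup.filter (fun σ => σ.2 = L)) =>
              ∑ R ∈ (Lᶜ).powerset, (if F.lab R = 4 ∧ P.1 ⊆ R ∧ R ⊆ σ.1.1 then (1 : ZMod 2) else 0)))) : ℤ))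
      + ∑ K ∈ (Finset.univ : Finset (Finset α)).filter (fun K => F.lab K = 4),
        (Module.finrank (ZMod 2) (Submodule.span (ZMod 2) (Set.range
          (fun Q : ↥((Kᶜ).powerset.filter (fun Q => F.lab Q = 3 ∧ F.lab (Kᶜ \ Q) = 0)) =>
            fun σ : ↥(F.sup.filter (fun σ => σ.2 = K)) =>
              ∑ R' ∈ (Kᶜ).powerset, (if F.lab R' = 0 ∧ (σ.1.1 ∪ σ.1.2)ᶜ ⊆ R' ∧ R' ⊆ Q.1 then (1 : ZMod 2) else 0)))) : ℤ)) :
    0 ≤ F.ZH := by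
  classical
  have hB : ∀ L ∈ (Finset.univ : Finset (Finset α)).filter (fun L => F.lab L = 0),
      (Module.finrank (ZMod 2) (Submodule.span (ZMod 2) (Set.range
          (fun P : ↥((Lᶜ).powerset.filter (fun P => F.lab P = 1 ∧ F.lab (Lᶜ \ P) = 4)) =>
            fun σ : ↥(F.sup.filter (fun σ => σ.2 = L)) =>
              ∑ R ∈ (Lᶜ).powerset, (if F.lab R = 4 ∧ P.1 ⊆ R ∧ R ⊆ σ.1.1 then (1 : ZMod 2) else 0)))) : ℤ)
        ≤ F.cubeSlack Lᶜ := by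
    intro L hL
    have hL0 : F.lab L = 0 := (mem_filter.1 hL).2
    refine F.finrank_span_le_cubeSlack L (Or.inr hL0) _ fun P d hd => ?_
    have hdL : d.1 = L := (mem_filter.1 hd).2
    subst hdL
    obtain ⟨hPW, hP1, hcP⟩ := mem_filter.1 P.2
    exact F.nu_orth_block (mem_filter.1 hd).1 hL0 (mem_powerset.1 hPW) hP1 hcP
  have hA : ∀ K ∈ (Finset.univ : Finset (Finset α)).filter (fun K => F.lab K = 4),
      (Module.finrank (ZMod 2) (Submodule.span (ZMod 2) (Set.range
          (fun Q : ↥((Kᶜ).powerset.filter (fun Q => F.lab Q = 3 ∧ F.lab (Kᶜ \ Q) = 0)) =>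
            fun σ : ↥(F.sup.filter (fun σ => σ.2 = K)) =>
              ∑ R' ∈ (Kᶜ).powerset, (if F.lab R' = 0 ∧ (σ.1.1 ∪ σ.1.2)ᶜ ⊆ R' ∧ R' ⊆ Q.1 then (1 : ZMod 2) else 0)))) : ℤ)
        ≤ F.cubeSlack Kᶜ := by
    intro K hK
    have hK4 : F.lab K = 4 := (mem_filter.1 hK).2
    refine F.finrank_span_le_cubeSlack K (Or.inl hK4) _ fun Q d hd => ?_
    have hdK : d.1 = K := (mem_filter.1 hd).2
    subst hdK
    obtain ⟨hQW, hQ3, hcQ⟩ := mem_filter.1 Q.2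
    exact F.mu_orth_block (mem_filter.1 hd).1 hK4 (mem_powerset.1 hQW) hQ3 hcQ
  have h1 := Finset.sum_le_sum hB
  have h2 := Finset.sum_le_sum hA
  rw [F.ZH_eq_six_slack]
  linarith

end Sunflower

end Summit.CriticalPhenomena.PercolationContinuityZ3.Theorems.SunflowerPartition
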